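import Summits.Ventures.PercRepro.MatroidColoopWindow
import Summits.Ventures.PercRepro.BinomialLayerN

/-!
# PercRepro — the middle level set, the sum form, and Lemma J₂ (coloops in the sum form at `q = 2`) (typer-2, gen 6)

mine-2's Theorem N (`proofs/MINE2-RLS.md` §14) is the SUM form `Φ(p, 2) · #U(p, 2) ≤ #Y(p, 2)` with
`Y(p, q) = {A ⊆ E : q < r(A) < p}` (the level set of `C025`); its Step 1 (LEMMA J₂) removes a coloop.

* **`midCount M p q`** — `#Y(p, q)`; **`midCount_eq_sum`** — `#Y(p, q) = Σ_{q<u<p} W_u` (`W_u = levelCount M u`);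
* **`sum_choose_mul_topCount_le`**, **`phi_mul_topCount_le_midCount`** — the windowed level-wise form
  `LevelwiseOn M p q` SUMS to the sum form `(Σ_{q<u<p} C(p+q,u)) / C(p+q,p) · #U(p, q) ≤ #Y(p, q)` (the body of
  `phiK p q`): this is how every level-wise theorem of the cell feeds `C025`;
* **`eRank_delete_add_one`** — `r(M) = r(M ＼ {e}) + 1` for a coloop `e`;
* **`topCount_eq_of_isColoop_of_eRank`** — LEMMA J₂ (a): `r(M) = p + 1` ⇒ `#U_M(p+1, q+1) = #U_{M ＼ {e}}(p, q+1)`;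
* **`midCount_eq_of_isColoop`** — LEMMA J₂ (b): `#Y_M(p+1, 2) = 2·#Y_{M'}(p, 2) + W_p(M') + W_2(M')`, `M' = M ＼ {e}`
  (`W_p(M')` = the spanning sets of `M'`, which has rank `p`);
* **`BinomialLayer.phiTwo_succ_le`** — `Φ(p+1, 2) ≤ 2·Φ(p, 2) + 1` for `p ≥ 4` (closed forms of stamp 88);
* **`sumForm_of_isColoop`** — LEMMA J₂: the sum form for `M ＼ {e}` at `p ≥ 4` gives it for `M` at `p + 1`;
  **`sumForm_of_isColoop_four`** — the base `r(M) = 4` needs no hypothesis on `M ＼ {e}` (`Φ(4, 2) = 4/3 ≤ 2`).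
(`M ＼ {e}` is written `M.delete {e}`, see `MatroidColoopWindow.lean`.)
-/

namespace PercRepro

open Set

namespace BinomialLayer

/-- `N1 / d1 ≤ 2 · (N2 / d2) + 1` from the cleared form `N1 · d2 ≤ (2·N2 + d2) · d1`. -/
theorem div_le_two_mul_div_add_one {N1 d1 N2 d2 : ℚ} (h1 : 0 < d1) (h2 : 0 < d2)
    (hN : N1 * d2 ≤ (2 * N2 + d2) * d1) : N1 / d1 ≤ 2 * (N2 / d2) + 1 := by
  rw [div_le_iff₀ h1]
  have : 2 * (N2 / d2) + 1 = (2 * N2 + d2) / d2 := by field_simp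
  rw [this, div_mul_eq_mul_div, le_div_iff₀ h2]
  exact hN

/-- **`Φ(p + 1, 2) ≤ 2·Φ(p, 2) + 1`** for `p ≥ 4` (mine-2 §14 Step 1: `Φ(p+1,2) = (2Φ(p,2) + 2)·(p+1)/(p+3)` and
`Φ(p, 2) ≥ (p − 1)/4`; here from the closed form `phiTwo_eq` and `2^{p+5} ≥ p³ + 10p² + 39p + 62`). -/
theorem phiTwo_succ_le (p : ℕ) (hp : 4 ≤ p) : phiTwo (p + 1) ≤ 2 * phiTwo p + 1 := by
  obtain ⟨m, rfl⟩ : ∃ m, p = m + 4 := ⟨p - 4, by omega⟩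
  have key : ∀ m : ℕ, ((m + 4 : ℚ) ^ 3 + 10 * (m + 4) ^ 2 + 39 * (m + 4) + 62) ≤ 2 ^ m * 512 := by
    intro m
    induction m with
    | zero => norm_num
    | succ m ih =>
      have hm : (0 : ℚ) ≤ m := by positivity
      rw [pow_succ (2 : ℚ) m]
      push_cast
      nlinarith [ih, mul_nonneg hm hm]
  have hk := key m
  have hm : (0 : ℚ) ≤ m := by positivity
  rw [phiTwo_eq (m + 4 + 1) (by omega), phiTwo_eq (m + 4) (by omega)]
  push_cast
  have e1 : (2 : ℚ) ^ (m + 4 + 1 + 2) = 2 ^ m * 128 := by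
    rw [show m + 4 + 1 + 2 = m + 7 by ring, pow_add]; norm_num
  have e2 : (2 : ℚ) ^ (m + 4 + 2) = 2 ^ m * 64 := by
    rw [show m + 4 + 2 = m + 6 by ring, pow_add]; norm_num
  rw [e1, e2]
  apply div_le_two_mul_div_add_one (by positivity) (by positivity)
  nlinarith [mul_nonneg (by positivity : (0 : ℚ) ≤ m + 6) (sub_nonneg.mpr hk)]

/-- `Φ(4, 2) = 4/3`. -/
theorem phiTwo_four : phiTwo 4 = 4 / 3 := by
  rw [phiTwo_eq 4 (by norm_num)]
  norm_num

end BinomialLayer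

namespace Matroid

variable {α : Type*} {M : _root_.Matroid α}

/-- `#Y(p, q)`: the number of `A ⊆ E` with `q < r(A) < p` (the middle level set of `C025`). -/
noncomputable def midCount (M : _root_.Matroid α) (p q : ℕ) : ℕ :=
  {A : Set α | A ⊆ M.E ∧ (q : ℕ∞) < M.eRk A ∧ M.eRk A < (p : ℕ∞)}.ncard

variable [M.Finite]

/-- **`#Y(p + 1, q) = #Y(p, q) + W_p`** for `q < p`. -/
theorem midCount_succ (p q : ℕ) (hqp : q < p) :
    midCount M (p + 1) q = midCount M p q + levelCount M p := by
  unfold midCount levelCount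
  have hsplit : {A : Set α | A ⊆ M.E ∧ (q : ℕ∞) < M.eRk A ∧ M.eRk A < ((p + 1 : ℕ) : ℕ∞)} =
      {A : Set α | A ⊆ M.E ∧ (q : ℕ∞) < M.eRk A ∧ M.eRk A < (p : ℕ∞)} ∪
      {A : Set α | A ⊆ M.E ∧ M.eRk A = (p : ℕ∞)} := by
    ext A
    simp only [Set.mem_setOf_eq, Set.mem_union]
    constructor
    · rintro ⟨hA, h1, h2⟩
      rw [Nat.cast_succ, ENat.lt_add_one_iff (ENat.coe_ne_top p)] at h2
      rcases h2.lt_or_eq with h2 | h2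
      · exact Or.inl ⟨hA, h1, h2⟩
      · exact Or.inr ⟨hA, h2⟩
    · rintro (⟨hA, h1, h2⟩ | ⟨hA, h2⟩)
      · exact ⟨hA, h1, h2.trans (by exact_mod_cast Nat.lt_succ_self p)⟩
      · refine ⟨hA, ?_, ?_⟩
        · rw [h2]; exact_mod_cast hqp
        · rw [h2]; exact_mod_cast Nat.lt_succ_self p
  have hdisj : Disjoint {A : Set α | A ⊆ M.E ∧ (q : ℕ∞) < M.eRk A ∧ M.eRk A < (p : ℕ∞)}
      {A : Set α | A ⊆ M.E ∧ M.eRk A = (p : ℕ∞)} := by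
    rw [Set.disjoint_left]
    rintro A ⟨_, _, h2⟩ ⟨_, h3⟩
    rw [h3] at h2
    exact lt_irrefl _ h2
  rw [hsplit, Set.ncard_union_eq hdisj (M.ground_finite.finite_subsets.subset fun A hA => hA.1)
    (M.ground_finite.finite_subsets.subset fun A hA => hA.1)]

/-- `#Y(q + 1, q) = 0`. -/
theorem midCount_succ_self (q : ℕ) : midCount M (q + 1) q = 0 := by
  unfold midCount
  rw [Set.ncard_eq_zero (M.ground_finite.finite_subsets.subset fun A hA => hA.1)]
  ext A
  simp only [Set.mem_setOf_eq, Set.mem_empty_iff_false, iff_false, not_and]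
  intro _ h1 h2
  rw [Nat.cast_succ, ENat.lt_add_one_iff (ENat.coe_ne_top q)] at h2
  exact absurd h1 (not_lt.mpr h2)

/-- **`#Y(p, q) = Σ_{q<u<p} W_u`** for `q < p`. -/
theorem midCount_eq_sum (p q : ℕ) (hqp : q < p) :
    midCount M p q = ∑ u ∈ Finset.Ioo q p, levelCount M u := by
  have hqp' : q + 1 ≤ p := hqp
  clear hqp
  induction p, hqp' using Nat.le_induction with
  | base =>
    rw [midCount_succ_self]
    have : Finset.Ioo q (q + 1) = ∅ := by
      ext x; simp only [Finset.mem_Ioo, Finset.notMem_empty, iff_false]; omega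
    rw [this, Finset.sum_empty]
  | succ p hqp ih =>
    rw [midCount_succ p q hqp, ih]
    have : Finset.Ioo q (p + 1) = insert p (Finset.Ioo q p) := by ext x; simp; omega
    rw [this, Finset.sum_insert (by simp)]
    ring

/-- **Level-wise ⇒ sum form**: the windowed level-wise inequalities summed over `q < u < p` give
`(Σ_{q<u<p} C(p+q, u)) · #U(p, q) ≤ C(p+q, p) · #Y(p, q)`. -/
theorem sum_choose_mul_topCount_le (p q : ℕ) (hqp : q < p) (h : LevelwiseOn M p q) :
    (∑ u ∈ Finset.Ioo q p, (p + q).choose u) * topCount M p q ≤ (p + q).choose p * midCount M p q := by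
  rw [midCount_eq_sum p q hqp, Finset.sum_mul, Finset.mul_sum]
  refine Finset.sum_le_sum fun u hu => ?_
  rw [Finset.mem_Ioo] at hu
  exact h u hu.1.le hu.2.le

/-- **Level-wise ⇒ sum form, in the spelling of `C025`**: `(Σ_{q<u<p} C(p+q,u)) / C(p+q,p) · #U(p, q) ≤ #Y(p, q)`
in `ℚ` (the left factor is the body of `phiK p q`). -/
theorem phi_mul_topCount_le_midCount (p q : ℕ) (hqp : q < p) (h : LevelwiseOn M p q) :
    (∑ u ∈ Finset.Ioo q p, (Nat.choose (p + q) u : ℚ)) / (Nat.choose (p + q) p : ℚ) * (topCount M p q : ℚ) ≤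
      (midCount M p q : ℚ) := by
  have hpos : (0 : ℚ) < (Nat.choose (p + q) p : ℚ) := by
    exact_mod_cast Nat.choose_pos (Nat.le_add_right p q)
  rw [div_mul_eq_mul_div, div_le_iff₀ hpos]
  calc (∑ u ∈ Finset.Ioo q p, (Nat.choose (p + q) u : ℚ)) * (topCount M p q : ℚ)
      = (((∑ u ∈ Finset.Ioo q p, (p + q).choose u) * topCount M p q : ℕ) : ℚ) := by push_cast; ring
    _ ≤ (((p + q).choose p * midCount M p q : ℕ) : ℚ) := by
        exact_mod_cast sum_choose_mul_topCount_le p q hqp h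
    _ = (midCount M p q : ℚ) * (Nat.choose (p + q) p : ℚ) := by push_cast; ring

/-- `W_u = 0` above the rank of `M`. -/
theorem levelCount_eq_zero_of_eRank_lt {u : ℕ} (h : M.eRank < u) : levelCount M u = 0 := by
  unfold levelCount
  rw [Set.ncard_eq_zero (M.ground_finite.finite_subsets.subset fun A hA => hA.1)]
  ext A
  simp only [Set.mem_setOf_eq, Set.mem_empty_iff_false, iff_false, not_and]
  intro _ hA
  have := (M.eRk_le_eRank A).trans_lt h
  rw [hA] at this
  exact lt_irrefl _ this

/-- A shift of the summation index: `Σ_{a+1<u<b+1} f(u − 1) = Σ_{a<v<b} f(v)`. -/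
theorem sum_Ioo_succ_shift (f : ℕ → ℕ) (a b : ℕ) :
    ∑ u ∈ Finset.Ioo (a + 1) (b + 1), f (u - 1) = ∑ v ∈ Finset.Ioo a b, f v := by
  refine Finset.sum_nbij' (fun u => u - 1) (fun v => v + 1) ?_ ?_ ?_ ?_ ?_
  · intro u hu; simp only [Finset.mem_Ioo] at hu ⊢; omega
  · intro v hv; simp only [Finset.mem_Ioo] at hv ⊢; omega
  · intro u hu; simp only [Finset.mem_Ioo] at hu; omega
  · intro v _; simp
  · intro u _; rfl

section Coloop

variable {e : α} (he : M.IsColoop e)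
include he

omit [M.Finite] in
/-- **`r(M) = r(M ＼ {e}) + 1`** for a coloop `e`. -/
theorem eRank_delete_add_one : (M.delete {e}).eRank + 1 = M.eRank := by
  have heT : e ∉ M.E \ {e} := fun h => h.2 (Set.mem_singleton e)
  rw [_root_.Matroid.eRank_def, _root_.Matroid.eRank_def, delete_singleton_ground,
    eRk_delete_of_notMem (T := M.E \ {e}) Set.sdiff_subset heT,
    ← eRk_insert_coloop he heT, Set.insert_sdiff_singleton,
    Set.insert_eq_of_mem he.mem_ground]

/-- If `r(M) = p + 1` and `e` is a coloop then `r(M ＼ {e}) = p`. -/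
theorem eRank_delete_eq {p : ℕ} (hR : M.eRank = ((p + 1 : ℕ) : ℕ∞)) : (M.delete {e}).eRank = p := by
  have h := eRank_delete_add_one he
  have hE : (M.delete {e}).E.Finite := by
    rw [delete_singleton_ground]
    exact M.ground_finite.sdiff
  have hfin : (M.delete {e}).eRank ≠ ⊤ :=
    ((M.delete {e}).eRank_le_encard_ground.trans_lt hE.encard_lt_top).ne
  obtain ⟨n, hn⟩ := ENat.ne_top_iff_exists.mp hfin
  rw [← hn, hR] at h
  rw [← hn]
  norm_cast at h ⊢
  omega

/-- **Lemma J₂ (a)** (mine-2 §14 Step 1): if `e` is a coloop and `r(M) = p + 1`, then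
`#U_M(p + 1, q + 1) = #U_{M ＼ {e}}(p, q + 1)` — the second summand of `topCount_succ_succ_eq_of_isColoop`
vanishes because `M ＼ {e}` has rank `p`. -/
theorem topCount_eq_of_isColoop_of_eRank {p : ℕ} (q : ℕ) (hR : M.eRank = ((p + 1 : ℕ) : ℕ∞)) :
    topCount M (p + 1) (q + 1) = topCount (M.delete {e}) p (q + 1) := by
  rw [topCount_succ_succ_eq_of_isColoop he]
  have h0 : topCount (M.delete {e}) (p + 1) q = 0 := by
    apply Nat.eq_zero_of_le_zero
    calc topCount (M.delete {e}) (p + 1) q ≤ levelCount (M.delete {e}) (p + 1) :=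
          topCount_le_levelCount_top _ _
      _ = 0 := levelCount_eq_zero_of_eRank_lt
          (by rw [eRank_delete_eq he hR]; exact_mod_cast Nat.lt_succ_self p)
  rw [h0, Nat.add_zero]

/-- **Lemma J₂ (b)** (mine-2 §14 Step 1): for a coloop `e` and `p ≥ 3`,
`#Y_M(p + 1, 2) = 2 · #Y_{M ＼ {e}}(p, 2) + W_p(M ＼ {e}) + W_2(M ＼ {e})`. -/
theorem midCount_eq_of_isColoop {p : ℕ} (hp : 2 < p) :
    midCount M (p + 1) 2 = 2 * midCount (M.delete {e}) p 2 + levelCount (M.delete {e}) p +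
      levelCount (M.delete {e}) 2 := by
  rw [midCount_eq_sum (p + 1) 2 (by omega), midCount_eq_sum p 2 hp]
  have hterm : ∀ u ∈ Finset.Ioo 2 (p + 1),
      levelCount M u = levelCount (M.delete {e}) u + levelCount (M.delete {e}) (u - 1) := by
    intro u hu
    rw [Finset.mem_Ioo] at hu
    obtain ⟨v, rfl⟩ : ∃ v, u = v + 1 := ⟨u - 1, by omega⟩
    rw [Nat.add_sub_cancel]
    exact levelCount_succ_eq_of_isColoop he v
  rw [Finset.sum_congr rfl hterm, Finset.sum_add_distrib]
  have hshift := sum_Ioo_succ_shift (fun v => levelCount (M.delete {e}) v) 1 p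
  norm_num at hshift
  rw [hshift]
  have h1 : Finset.Ioo 2 (p + 1) = insert p (Finset.Ioo 2 p) := by ext x; simp; omega
  have h2 : Finset.Ioo 1 p = insert 2 (Finset.Ioo 2 p) := by ext x; simp; omega
  rw [h1, h2, Finset.sum_insert (by simp), Finset.sum_insert (by simp)]
  ring

/-- **Lemma J₂** (mine-2 §14 Step 1, the sum form of Theorem N): `e` a coloop, `r(M) = p + 1`, `p ≥ 4`; if
`M ＼ {e}` satisfies `Φ(p, 2) · #U(p, 2) ≤ #Y(p, 2)` then `M` satisfies `Φ(p + 1, 2) · #U(p + 1, 2) ≤ #Y(p + 1, 2)`: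
`#U_M = #U_{M'}`, `#Y_M = 2·#Y_{M'} + W_p(M') + W_2(M') ≥ (2Φ(p,2) + 1)·#U_{M'}` by the two injections, and
`Φ(p + 1, 2) ≤ 2Φ(p, 2) + 1`. -/
theorem sumForm_of_isColoop {p : ℕ} (hp : 4 ≤ p) (hR : M.eRank = ((p + 1 : ℕ) : ℕ∞))
    (hIH : BinomialLayer.phiTwo p * (topCount (M.delete {e}) p 2 : ℚ) ≤
      (midCount (M.delete {e}) p 2 : ℚ)) :
    BinomialLayer.phiTwo (p + 1) * (topCount M (p + 1) 2 : ℚ) ≤ (midCount M (p + 1) 2 : ℚ) := by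
  have hU : topCount M (p + 1) 2 = topCount (M.delete {e}) p 2 :=
    topCount_eq_of_isColoop_of_eRank he 1 hR
  rw [hU, midCount_eq_of_isColoop he (by omega)]
  push_cast
  have hΦ := BinomialLayer.phiTwo_succ_le p hp
  have htop : (topCount (M.delete {e}) p 2 : ℚ) ≤ levelCount (M.delete {e}) p := by
    exact_mod_cast topCount_le_levelCount_top p 2
  have hbot : (topCount (M.delete {e}) p 2 : ℚ) ≤ levelCount (M.delete {e}) 2 := by
    exact_mod_cast topCount_le_levelCount_bot p 2
  have hU0 : (0 : ℚ) ≤ topCount (M.delete {e}) p 2 := by positivity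
  nlinarith [hΦ, hIH, htop, hbot, hU0]

/-- **Lemma J₂ at `r(M) = 4`**: a coloop `e` and `r(M) = 4` give `Φ(4, 2) · #U(4, 2) ≤ #Y(4, 2)` with no
hypothesis on `M ＼ {e}` (`Φ(4, 2) = 4/3 ≤ 2` and `#Y_M ≥ W_3(M') + W_2(M') ≥ 2·#U_{M'}(3, 2) = 2·#U_M`). -/
theorem sumForm_of_isColoop_four (hR : M.eRank = ((3 + 1 : ℕ) : ℕ∞)) :
    BinomialLayer.phiTwo (3 + 1) * (topCount M (3 + 1) 2 : ℚ) ≤ (midCount M (3 + 1) 2 : ℚ) := by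
  have hU : topCount M (3 + 1) 2 = topCount (M.delete {e}) 3 2 :=
    topCount_eq_of_isColoop_of_eRank he 1 hR
  rw [hU, midCount_eq_of_isColoop he (by omega), BinomialLayer.phiTwo_four]
  push_cast
  have htop : (topCount (M.delete {e}) 3 2 : ℚ) ≤ levelCount (M.delete {e}) 3 := by
    exact_mod_cast topCount_le_levelCount_top 3 2
  have hbot : (topCount (M.delete {e}) 3 2 : ℚ) ≤ levelCount (M.delete {e}) 2 := by
    exact_mod_cast topCount_le_levelCount_bot 3 2
  have hU0 : (0 : ℚ) ≤ topCount (M.delete {e}) 3 2 := by positivity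
  have hY0 : (0 : ℚ) ≤ midCount (M.delete {e}) 3 2 := by positivity
  nlinarith [htop, hbot, hU0, hY0]

end Coloop

end Matroid

end PercRepro
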